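import Summits.Ventures.HSemireg.WedgeHankelSubstitutionClassSpace

/-!
# Venture HSemireg — THE JORDAN TYPE OF A PARABOLIC SUBSTITUTION ON THE CLASS SPACE, IN EVERY CHARACTERISTIC: `(Φs λ − 1)^n · w_n(q) = n!·λ^n·q₀ · E_n`,
# so `Φs λ` is ONE Jordan block on the classes (`minpoly = (X − 1)^{n+1}`) iff `n!·λ^n ≠ 0` in `K`, while `(Φs λ)^m = Φs (mλ)` makes it an automorphism of
# order `p` in characteristic `p` (then `(Φs λ − 1)^n = 0` as soon as `p ≤ n`)

HONEST FRAMING. Part of the Lean index of the computation cell `pub-hsemireg` (seat p10 gen 19, Sunday typer «UNIFORM-IN-n»).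
Finite-dimensional EXTERIOR ALGEBRA + linear algebra ONLY: no variety, no cohomology theory, no sheaf, no Ext group, no semiregularity map;
nothing here says that HC / HC_CM / HC_AV holds; no Literature fact is declared or used.  Custodian versions as in `WedgeHankelSiegelIdeal` (1/3) and `WedgeHankelFrameChange`.

WHAT IS IN THE TREE.  E5 `Φs`, `Φs_w` (`w_n(q) ↦ w_n(expMul λ q)`), `expMul_eq_sum` (`Σ_{i≤j} C(j,i) λ^{j−i} q_i`), F `Φs_Φs_w` (`Φs λ ∘ Φs d = Φs (λ+d)` on classes);
H1 `Φs_eq_Sb` (`Φs λ = Sb 1 λ 0 1`); H1b `w_eq_w_iff`; I8 (`WedgeHankelSubstitutionParabolic`): for `λ ≠ 0` and `1, …, n ≠ 0` in `K` the shear has exactly ONE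
eigen-class (`Φs_eigen_mem_span_point`); I9/I11: `χ(S_n(shear)) = (X − 1)^{n+1}` (`charpoly_SbC_shear`), `(S_n − 1)^{n+1} = 0`; I11 `spikeSpan`, `spikeBasis`, `SbC`.
THIS FILE (namespace `…Wedge.HankelFrameChange` continued; imports I11) completes the picture of the unipotent substitution `x ↦ x + λy` on th-7's classes, uniformly in
`n` AND in the characteristic:
* §210 the DIFFERENCE OPERATOR `dMul λ q := expMul λ q − q` (`(dMul λ q)_j = Σ_{i<j} C(j,i) λ^{j−i} q_i`) and its iterates: **`(dMul λ)^k q` VANISHES below index `k` and equals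
  `k!·λ^k·q₀` AT index `k`** (`iterate_dMul_apply_of_lt`, `iterate_dMul_apply_self`).
* §211 on the class space: `(SbC(shear λ) − 1)^k · w_n(q) = w_n((dMul λ)^k q)`; hence **`(SbC(shear λ) − 1)^n · w_n(q) = (n!·λ^n·q₀) · E_n`** (the Jordan chain ends in the POINT
  class, I8's unique eigen-class), `(SbC(shear λ) − 1)^{n+1} = 0` (basis-free re-derivation), **`(SbC(shear λ) − 1)^n = 0 ↔ n!·λ^n = 0`**, `(SbC(shear λ) − 1)^k ≠ 0` for
  `k ≤ n` with `k!·λ^k ≠ 0`, and **`minpoly (SbC(shear λ)) = (X − 1)^{n+1}` when `n!·λ^n ≠ 0`** — ONE JORDAN BLOCK of size `n + 1` (with I8: one eigen-line).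
* §212 the other side of the dichotomy: **`SbC(shear a) ∘ SbC(shear b) = SbC(shear (a+b))`**, `SbC(shear λ)^m = SbC(shear (m·λ))`, so `SbC(shear λ)^m = 1` whenever `m = 0` in
  `K`: in characteristic `p` the substitution has ORDER `p`, and **for a prime `p ≤ n` with `p = 0` in `K`, `(SbC(shear λ) − 1)^n = 0`** — NOT one Jordan block (all
  blocks have size `≤ p`; not typed: the exact partition).
NOT typed here: the general parabolic `g` (conjugate to a shear times a scalar: I8 §185 `Sb_lower_parabolic_eq_comp`, I9 §187); the block partition in characteristic `p ≤ n`;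
anything Ext-side.  New names only.
-/

open Module

namespace Summit.Ventures.HSemireg.Wedge.HankelFrameChange

open Summit.Ventures.HSemireg.Wedge Summit.Ventures.HSemireg.Wedge.Kunneth Summit.Ventures.HSemireg.Wedge.Hankel
  Summit.Ventures.HSemireg.Wedge.BasisFree Summit.Ventures.HSemireg.Wedge.HankelSiegel Summit.Ventures.HSemireg.Wedge.HankelSiegelIdeal
  Summit.Ventures.HSemireg.Wedge.KunnethKernel Summit.Ventures.HSemireg.Wedge.HankelRankOne Summit.Ventures.HSemireg.Wedge.KernelDuality

variable (K : Type*) [Field K] {n : ℕ}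

/-! ## §210. The difference operator `dMul λ = expMul λ − 1` on coefficient sequences and its iterates -/

/-- **THE DIFFERENCE OPERATOR** `(dMul λ q)_j := (expMul λ q)_j − q_j` (the coefficient action of `Φs λ − 1` on th-7's classes). -/
def dMul (lam : K) (q : ℕ → K) : ℕ → K := fun j => expMul K lam q j - q j

/-- `(dMul λ q)_j = (expMul λ q)_j − q_j`. -/
lemma dMul_apply (lam : K) (q : ℕ → K) (j : ℕ) : dMul K lam q j = expMul K lam q j - q j := rfl

/-- **`(dMul λ q)_j = Σ_{i<j} C(j,i) λ^{j−i} q_i`** (the diagonal term of `expMul_eq_sum` cancels): `dMul λ` is strictly triangular. -/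
theorem dMul_eq_sum (lam : K) (q : ℕ → K) (j : ℕ) :
    dMul K lam q j = ∑ i ∈ Finset.range j, (j.choose i : K) * lam ^ (j - i) * q i := by
  rw [dMul_apply, expMul_eq_sum, Finset.sum_range_succ, Nat.choose_self, Nat.cast_one, one_mul, Nat.sub_self, pow_zero, one_mul,
    add_sub_cancel_right]

/-- `(dMul λ q)_0 = 0`. -/
lemma dMul_apply_zero (lam : K) (q : ℕ → K) : dMul K lam q 0 = 0 := by
  rw [dMul_eq_sum, Finset.sum_range_zero]

/-- if `q` vanishes below `k`, then `dMul λ q` vanishes below `k + 1` … -/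
lemma dMul_apply_of_vanish {lam : K} {q : ℕ → K} {k : ℕ} (hq : ∀ i < k, q i = 0) {j : ℕ} (hj : j ≤ k) : dMul K lam q j = 0 := by
  rw [dMul_eq_sum]
  exact Finset.sum_eq_zero fun i hi => by rw [Finset.mem_range] at hi; rw [hq i (by omega), mul_zero]

/-- … and `(dMul λ q)_{k+1} = (k+1)·λ·q_k`. -/
lemma dMul_apply_succ_of_vanish {lam : K} {q : ℕ → K} {k : ℕ} (hq : ∀ i < k, q i = 0) :
    dMul K lam q (k + 1) = ((k + 1 : ℕ) : K) * lam * q k := by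
  rw [dMul_eq_sum, Finset.sum_range_succ, Finset.sum_eq_zero fun i hi => ?_, zero_add, Nat.choose_succ_self_right,
    show k + 1 - k = 1 by omega, pow_one]
  rw [Finset.mem_range] at hi
  rw [hq i hi, mul_zero]

/-- **THE ITERATES VANISH BELOW THE DIAGONAL: `((dMul λ)^k q)_j = 0` for `j < k`.** -/
theorem iterate_dMul_apply_of_lt (lam : K) (k : ℕ) : ∀ (q : ℕ → K) {j : ℕ}, j < k → (dMul K lam)^[k] q j = 0 := by
  induction k with
  | zero => intro q j hj; omega
  | succ k ih =>
    intro q j hj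
    rw [Function.iterate_succ_apply']
    exact dMul_apply_of_vanish K (fun i hi => ih q hi) (by omega)

/-- **ON THE DIAGONAL: `((dMul λ)^k q)_k = k!·λ^k·q₀`.** -/
theorem iterate_dMul_apply_self (lam : K) (k : ℕ) : ∀ q : ℕ → K, (dMul K lam)^[k] q k = (k.factorial : K) * lam ^ k * q 0 := by
  induction k with
  | zero => intro q; simp
  | succ k ih =>
    intro q
    rw [Function.iterate_succ_apply', dMul_apply_succ_of_vanish K (fun i hi => iterate_dMul_apply_of_lt K lam k q hi), ih q,
      Nat.factorial_succ, Nat.cast_mul]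
    ring

/-! ## §211. The Jordan chain of the shear on the class space -/

/-- `w_n` of a difference of sequences. -/
private lemma w_sub (q q' : ℕ → K) : w K n n (fun j => q j - q' j) = w K n n q - w K n n q' := by
  rw [sub_eq_add_neg, ← neg_one_smul K (w K n n q'), ← w_smul, ← w_add]; congr 1; funext j; ring

/-- `Sb 1 λ 0 1 = Φs λ` on forms (H1 `Φs_eq_Sb`). -/
private lemma Sb_shear_apply (lam : K) (f : HT K (In n)) : Sb K 1 lam 0 1 f = Φs K lam f := by
  rw [← Φs_eq_Sb]; rfl

/-- **`(SbC(shear λ) − 1) · w_n(q) = w_n(dMul λ q)`.** -/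
theorem SbC_shear_sub_one_apply_w (lam : K) (q : ℕ → K) :
    (SbC K 1 lam 0 1 - 1) ⟨w K n n q, w_mem_spikeSpan K q⟩ = ⟨w K n n (dMul K lam q), w_mem_spikeSpan K _⟩ := by
  apply Subtype.ext
  rw [LinearMap.sub_apply, Module.End.one_apply, Submodule.coe_sub, SbC_apply_coe, Sb_shear_apply, Φs_w K lam le_rfl]
  exact (w_sub K _ _).symm

/-- **`(SbC(shear λ) − 1)^k · w_n(q) = w_n((dMul λ)^k q)`.** -/
theorem SbC_shear_sub_one_pow_apply_w (lam : K) (k : ℕ) (q : ℕ → K) :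
    ((SbC K 1 lam 0 1 - 1) ^ k) ⟨w K n n q, w_mem_spikeSpan K q⟩ = ⟨w K n n ((dMul K lam)^[k] q), w_mem_spikeSpan K _⟩ := by
  induction k with
  | zero => rfl
  | succ k ih => rw [pow_succ', Module.End.mul_apply, ih, SbC_shear_sub_one_apply_w, ← Function.iterate_succ_apply' (dMul K lam)]

/-- **THE JORDAN CHAIN ENDS IN THE POINT CLASS: `(SbC(shear λ) − 1)^n · w_n(q) = (n!·λ^n·q₀) · E_n`** (`E_n = w_n(δ_n)`, I8's unique eigen-class of the shear). -/
theorem SbC_shear_sub_one_pow_self_apply_w (lam : K) (q : ℕ → K) :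
    ((SbC K 1 lam 0 1 - 1) ^ n) ⟨w K n n q, w_mem_spikeSpan K q⟩ =
      ((n.factorial : K) * lam ^ n * q 0) • ⟨w K n n (fun j => if j = n then (1 : K) else 0), w_mem_spikeSpan K _⟩ := by
  rw [SbC_shear_sub_one_pow_apply_w]
  apply Subtype.ext
  rw [Submodule.coe_smul, ← w_smul]
  refine (w_eq_w_iff K _ _).2 fun j hj => ?_
  rcases Nat.lt_or_ge j n with h | h
  · rw [iterate_dMul_apply_of_lt K lam n q h, if_neg (by omega), mul_zero]
  · rw [show j = n by omega, iterate_dMul_apply_self, if_pos rfl, mul_one]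

/-- **in particular `(SbC(shear λ) − 1)^n · E_0 = (n!·λ^n) · E_n`.** -/
theorem SbC_shear_sub_one_pow_self_apply_spike_zero (lam : K) :
    ((SbC K 1 lam 0 1 - 1) ^ n) ⟨w K n n (fun j => if j = 0 then (1 : K) else 0), w_mem_spikeSpan K _⟩ =
      ((n.factorial : K) * lam ^ n) • ⟨w K n n (fun j => if j = n then (1 : K) else 0), w_mem_spikeSpan K _⟩ := by
  rw [SbC_shear_sub_one_pow_self_apply_w, if_pos rfl, mul_one]

/-- every element of the class space is a `w_n(q)` (through th-7's spike basis). -/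
private lemma exists_eq_w_of_mem_spikeSpan (f : spikeSpan K n) : ∃ q : ℕ → K, (f : HT K (In n)) = w K n n q := by
  refine ⟨fun j => if h : j < n + 1 then (spikeBasis K n).repr f ⟨j, h⟩ else 0, ?_⟩
  conv_lhs => rw [← (spikeBasis K n).sum_repr f]
  rw [Submodule.coe_sum]
  simp_rw [Submodule.coe_smul, spikeBasis_coe, ← w_smul]
  rw [← w_finsum]
  refine (w_eq_w_iff K _ _).2 fun j hj => ?_
  rw [dif_pos (Nat.lt_succ_of_le hj), Finset.sum_eq_single (⟨j, Nat.lt_succ_of_le hj⟩ : Fin (n + 1)) (fun p _ hp => ?_)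
    (fun h => absurd (Finset.mem_univ _) h), if_pos rfl, mul_one]
  rw [if_neg (fun e => hp (Fin.ext e.symm)), mul_zero]

/-- **`(SbC(shear λ) − 1)^{n+1} = 0`** (basis-free re-derivation of I9/I11's Cayley–Hamilton consequence). -/
theorem SbC_shear_sub_one_pow_succ (lam : K) : (SbC K 1 lam 0 1 - 1) ^ (n + 1) = (0 : spikeSpan K n →ₗ[K] spikeSpan K n) := by
  refine LinearMap.ext fun f => ?_
  obtain ⟨q, hq⟩ := exists_eq_w_of_mem_spikeSpan K f
  have ef : f = ⟨w K n n q, w_mem_spikeSpan K q⟩ := Subtype.ext hq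
  rw [ef, SbC_shear_sub_one_pow_apply_w, LinearMap.zero_apply]
  apply Subtype.ext
  rw [Submodule.coe_zero, ← w_zero K (n := n) n]
  exact (w_eq_w_iff K _ _).2 fun j hj => iterate_dMul_apply_of_lt K lam (n + 1) q (by omega)

/-- **`(SbC(shear λ) − 1)^n = 0 ↔ n!·λ^n = 0` in `K`** (every field, every `n`). -/
theorem SbC_shear_sub_one_pow_self_eq_zero_iff (lam : K) :
    (SbC K 1 lam 0 1 - 1) ^ n = (0 : spikeSpan K n →ₗ[K] spikeSpan K n) ↔ (n.factorial : K) * lam ^ n = 0 := by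
  constructor
  · intro h
    have h0 := SbC_shear_sub_one_pow_self_apply_spike_zero K lam (n := n)
    rw [h, LinearMap.zero_apply, eq_comm, smul_eq_zero] at h0
    refine h0.resolve_right fun e => ?_
    have e' := congrArg Subtype.val e
    rw [Submodule.coe_zero, ← w_zero K (n := n) n, w_eq_w_iff] at e'
    exact absurd (by simpa using e' n le_rfl : (1 : K) = 0) one_ne_zero
  · intro h
    refine LinearMap.ext fun f => ?_
    obtain ⟨q, hq⟩ := exists_eq_w_of_mem_spikeSpan K f
    have ef : f = ⟨w K n n q, w_mem_spikeSpan K q⟩ := Subtype.ext hq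
    rw [ef, SbC_shear_sub_one_pow_self_apply_w, h, zero_mul, zero_smul, LinearMap.zero_apply]

/-- **the lower powers do not vanish: `(SbC(shear λ) − 1)^k ≠ 0` for `k ≤ n` with `k!·λ^k ≠ 0`** (it sends `E_0` to a class with `E_k`-coordinate `k!·λ^k`). -/
theorem SbC_shear_sub_one_pow_ne_zero (lam : K) {k : ℕ} (hk : k ≤ n) (h : (k.factorial : K) * lam ^ k ≠ 0) :
    (SbC K 1 lam 0 1 - 1) ^ k ≠ (0 : spikeSpan K n →ₗ[K] spikeSpan K n) := by
  intro e
  have h0 := SbC_shear_sub_one_pow_apply_w K lam k (n := n) (fun j => if j = 0 then (1 : K) else 0)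
  rw [e, LinearMap.zero_apply] at h0
  have h1 := congrArg Subtype.val h0
  rw [Submodule.coe_zero, ← w_zero K (n := n) n, w_eq_w_iff] at h1
  have h2 := h1 k hk
  rw [iterate_dMul_apply_self, if_pos rfl, mul_one] at h2
  exact h (by simpa using h2.symm)

/-- **ONE JORDAN BLOCK: `minpoly (SbC(shear λ)) = (X − 1)^{n+1}` whenever `n!·λ^n ≠ 0`** (e.g. `λ ≠ 0` in characteristic `0` or `> n`); with I8: the eigen-space is the
line of the point class. -/
theorem minpoly_SbC_shear (lam : K) (h : (n.factorial : K) * lam ^ n ≠ 0) :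
    minpoly K (SbC K 1 lam 0 1 (n := n)) = (Polynomial.X - Polynomial.C 1) ^ (n + 1) := by
  have hirr : Irreducible (Polynomial.X - Polynomial.C (1 : K)) := Polynomial.irreducible_X_sub_C 1
  have hdvd : minpoly K (SbC K 1 lam 0 1 (n := n)) ∣ (Polynomial.X - Polynomial.C 1) ^ (n + 1) := by
    rw [← charpoly_SbC_shear K lam]; exact LinearMap.minpoly_dvd_charpoly _
  obtain ⟨j, hj, hassoc⟩ := (dvd_prime_pow hirr.prime _).1 hdvd
  have hmonic : (minpoly K (SbC K 1 lam 0 1 (n := n))).Monic := minpoly.monic (LinearMap.isIntegral _)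
  have heq : minpoly K (SbC K 1 lam 0 1 (n := n)) = (Polynomial.X - Polynomial.C 1) ^ j :=
    Polynomial.eq_of_monic_of_associated hmonic ((Polynomial.monic_X_sub_C 1).pow j) hassoc
  rcases Nat.lt_or_ge j (n + 1) with hlt | hge
  · exfalso
    have h0 : (SbC K 1 lam 0 1 (n := n) - 1) ^ j = 0 := by
      have := minpoly.aeval K (SbC K 1 lam 0 1 (n := n))
      rwa [heq, map_pow, map_sub, Polynomial.aeval_X, Polynomial.aeval_C, map_one] at this
    have hn : (SbC K 1 lam 0 1 (n := n) - 1) ^ n = 0 := pow_eq_zero_of_le (Nat.le_of_lt_succ hlt) h0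
    exact h ((SbC_shear_sub_one_pow_self_eq_zero_iff K lam).1 hn)
  · rw [heq, le_antisymm hj hge]

/-! ## §212. The other side: the shear has order `p` in characteristic `p` -/

/-- **`SbC(shear a) ∘ SbC(shear b) = SbC(shear (a + b))`** (F `Φs_Φs_w` on the class space). -/
theorem SbC_shear_mul_shear (a b : K) : SbC K 1 a 0 1 (n := n) * SbC K 1 b 0 1 = SbC K 1 (a + b) 0 1 := by
  refine LinearMap.ext fun f => ?_
  obtain ⟨q, hq⟩ := exists_eq_w_of_mem_spikeSpan K f
  apply Subtype.ext
  rw [Module.End.mul_apply, SbC_apply_coe, SbC_apply_coe, SbC_apply_coe, hq, Sb_shear_apply, Sb_shear_apply, Sb_shear_apply, Φs_Φs_w,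
    Φs_w K (a + b) le_rfl]

/-- `SbC(shear 0) = 1`. -/
theorem SbC_shear_zero : SbC K 1 0 0 1 (n := n) = 1 := by
  refine LinearMap.ext fun f => ?_
  obtain ⟨q, hq⟩ := exists_eq_w_of_mem_spikeSpan K f
  apply Subtype.ext
  rw [SbC_apply_coe, Module.End.one_apply, hq, Sb_shear_apply, Φs_w K 0 le_rfl]
  exact (w_eq_w_iff K _ _).2 fun j _ => expMul_zero_left K q j

/-- **`SbC(shear λ)^m = SbC(shear (m·λ))`.** -/
theorem SbC_shear_pow (lam : K) (m : ℕ) : SbC K 1 lam 0 1 (n := n) ^ m = SbC K 1 ((m : K) * lam) 0 1 := by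
  induction m with
  | zero => rw [pow_zero, Nat.cast_zero, zero_mul, SbC_shear_zero]
  | succ m ih => rw [pow_succ, ih, SbC_shear_mul_shear, Nat.cast_succ]; congr 1; ring

/-- **`SbC(shear λ)^m = 1` whenever `m = 0` in `K`:** in characteristic `p` the unipotent substitution has ORDER `p`. -/
theorem SbC_shear_pow_eq_one_of_cast_eq_zero (lam : K) {m : ℕ} (hm : (m : K) = 0) : SbC K 1 lam 0 1 (n := n) ^ m = 1 := by
  rw [SbC_shear_pow, hm, zero_mul, SbC_shear_zero]

/-- **for a prime `p ≤ n` with `p = 0` in `K`: `(SbC(shear λ) − 1)^n = 0`** — in characteristic `p ≤ n` the shear is NOT one Jordan block on the classes (compare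
`minpoly_SbC_shear`). -/
theorem SbC_shear_sub_one_pow_self_eq_zero_of_prime_le (lam : K) {p : ℕ} (hp : p.Prime) (hpK : (p : K) = 0) (hpn : p ≤ n) :
    (SbC K 1 lam 0 1 - 1) ^ n = (0 : spikeSpan K n →ₗ[K] spikeSpan K n) := by
  rw [SbC_shear_sub_one_pow_self_eq_zero_iff]
  obtain ⟨c, hc⟩ := hp.dvd_factorial.2 hpn
  rw [hc, Nat.cast_mul, hpK, zero_mul, zero_mul]

end Summit.Ventures.HSemireg.Wedge.HankelFrameChange
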